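import Literature.Topology.FourManifolds.SlideCharts
import Literature.Topology.FourManifolds.UnorientedDiscTheoremDiffeotopy
import Literature.Topology.FourManifolds.HCobordismLevelDeformationOrientation
import HarnessLib

/-!
# The docking of the one-slide step: an isotopy of the level `V₀`, supported off the right-hand
# spheres, carrying a flat piece of `S_L(p₁)` onto the sheet `{s = 1, y = 0}` of the model about
# `S_R(p₂)` (Milnor 1965, Lemma 7.7, property 2.) for `S_L`)

Topic `Literature/Topology/FourManifolds`; part of the proof of the one-slide step of the Basis
Theorem 7.6 on a slab (`Literature.Topology.FourManifolds.Cobordism.Milnor1965_basisTheorem_slab_of_slideStep`).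
Milnor, *Lectures on the h-cobordism theorem* (1965), Lemma 7.7 (PDF p. 51 of the held copy)
asks for one embedding `φ` of the model with `φ⁻¹(S_L) = 1 × R^{λ-1} × 0` AND
`φ⁻¹(S_R(p₂)) = 2 × 0 × R^{n-λ-1}`, built from a Riemannian metric making the spheres totally
geodesic.  The tree fixes instead the model `ψ_R` about `S_R(p₂)` (`SlideCharts.lean`: in it
`S_R(σ j)` is exactly `{s = 2, x = 0}`) and MOVES `S_L` by an isotopy of `V₀` supported in
`W = V₀ ∖ ⋃ S_R` — which Lemma 4.7 absorbs into the gradient-like field above `V₀` without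
changing any right-hand sphere — so that afterwards a flat piece of the moved `S_L` is exactly
the sheet `{s = 1, y = 0}` of `ψ_R` near its centre.  The isotopy is the disc theorem of
Palais–Cerf–Hirsch in `W` (connected: `SlideSetting.isPreconnected_W`), without orientation
hypotheses (`Literature.Topology.FourManifolds.exists_isCompactlyDiffeotopicToIdIn_apply_disc_eq_or_reflect`),
applied to the docking discs `discA ρ` (centred on `S_L`, flattening it) and `discB` (centred at
`ψ_R(1, 0, 0)`):

* **`SlideSetting.exists_docking`** — for each isometry `ρ` of the sheet directions there is a
  diffeomorphism `f` of `V`, compactly diffeotopic to the identity inside `W`, and a linear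
  automorphism `τ` of `ℝⁿ` preserving the flat and fixing it pointwise (`τ` is the identity or the
  disc theorem's reflection, conjugated into the source of `discA`), with
  `f (discA ρ (τ v)) = discB v` for `‖v‖ ≤ 1`; consequently
  `f(S_L) ∩ discB(B̄(0, 1)) = discB(B̄(0, 1) ∩ Flat)` — inside the control ball the moved sphere
  is exactly the flat sheet.

Everything is proved; no definitions, no named facts.

## References

* J. Milnor, *Lectures on the h-cobordism theorem*, notes by L. Siebenmann and J. Sondow,
  Princeton Mathematical Notes (1965), Lemma 7.7 and proof of Thm. 7.6 (PDF pp. 50–52),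
  Lemma 4.7 (PDF p. 25).  Held: `lit read book:milnornd-lectures-h-cobordism-theorem`.
  [MilnorHCobordism1965]
* M. W. Hirsch, *Differential Topology*, GTM 33 (1976), Ch. 8 §3, Thm. 3.1. [HirschDT1976]
-/

open scoped Manifold ContDiff Topology
open Set Function Filter Metric Module

noncomputable section

namespace Literature.Topology.FourManifolds

universe u

section Docking

variable {n : ℕ} {M N : Type u} [TopologicalSpace M] [ChartedSpace (EuclideanSpace ℝ (Fin n)) M]
  [TopologicalSpace N] [ChartedSpace (EuclideanSpace ℝ (Fin n)) N]

namespace SlideSetting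

variable {c : Cobordism n M N} {g : c.W → ℝ}
  {ξ : Cₛ^∞⟮𝓡∂ (n + 1); EuclideanSpace ℝ (Fin (n + 1)), (TangentSpace (𝓡∂ (n + 1)) : c.W → Type)⟯}
  {t₀ t₁ b : ℝ} {k a : ℕ} {σ : Fin a → c.W} {i j : Fin a}
  (S : SlideSetting c g ξ t₀ t₁ b k σ i j)

/-- The control disc `discB` is an open map: images of open sets are open in the level (it is the
chart `ThetaB` with source `univ`). [folklore] -/
theorem isOpen_image_discB {U : Set (EuclideanSpace ℝ (Fin n))} (hU : IsOpen U) : IsOpen (S.discB '' U) := by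
  have h := S.ThetaB.isOpen_image_of_subset_source hU (by rw [S.ThetaB_source]; exact subset_univ _)
  have e : (S.ThetaB : EuclideanSpace ℝ (Fin n) → S.V) = S.discB := funext S.ThetaB_apply
  rwa [e] at h

/-- The docking disc `discA ρ` is an open map. [folklore] -/
theorem isOpen_image_discA (ρ : (EuclideanSpace ℝ (Fin (k - 1))) ≃ₗᵢ[ℝ] EuclideanSpace ℝ (Fin (k - 1)))
    {U : Set (EuclideanSpace ℝ (Fin n))} (hU : IsOpen U) : IsOpen (S.discA ρ '' U) := by
  have h := (S.ThetaA ρ).isOpen_image_of_subset_source hU (by rw [S.ThetaA_source]; exact subset_univ _)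
  have e : (S.ThetaA ρ : EuclideanSpace ℝ (Fin n) → S.V) = S.discA ρ := funext (S.ThetaA_apply ρ)
  rwa [e] at h

/-- `discB` is continuous. [folklore] -/
theorem continuous_discB : Continuous S.discB := by
  have h := S.ThetaB.continuousOn
  have e : (S.ThetaB : EuclideanSpace ℝ (Fin n) → S.V) = S.discB := funext S.ThetaB_apply
  rwa [S.ThetaB_source, continuousOn_univ, e] at h

/-- `discA ρ` is continuous. [folklore] -/
theorem continuous_discA (ρ : (EuclideanSpace ℝ (Fin (k - 1))) ≃ₗᵢ[ℝ] EuclideanSpace ℝ (Fin (k - 1))) :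
    Continuous (S.discA ρ) := by
  have h := (S.ThetaA ρ).continuousOn
  have e : (S.ThetaA ρ : EuclideanSpace ℝ (Fin n) → S.V) = S.discA ρ := funext (S.ThetaA_apply ρ)
  rwa [S.ThetaA_source, continuousOn_univ, e] at h

/-- **A reflection of `ℝⁿ` of negative determinant preserving the flat and fixing it
pointwise**: the reflection of one `y`-coordinate of the model, conjugated by `L₃`
(`n - k ≥ 1`). [folklore] -/
theorem exists_reflection_flat :
    ∃ r : (EuclideanSpace ℝ (Fin n)) ≃L[ℝ] EuclideanSpace ℝ (Fin n),
      LinearMap.det (r.toLinearEquiv : (EuclideanSpace ℝ (Fin n)) →ₗ[ℝ] EuclideanSpace ℝ (Fin n)) < 0 ∧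
      (∀ v, r v ∈ S.Flat ↔ v ∈ S.Flat) ∧ (∀ v ∈ S.Flat, r v = v) := by
  have hnk : 0 < n - k := by have := S.hkn; omega
  set j0 : Fin (n - k) := ⟨0, hnk⟩ with hj0
  set Ry : (EuclideanSpace ℝ (Fin (n - k))) ≃L[ℝ] EuclideanSpace ℝ (Fin (n - k)) :=
    (coordReflection j0).toContinuousLinearEquiv with hRy
  set R : Model n k ≃L[ℝ] Model n k :=
    (ContinuousLinearEquiv.refl ℝ ℝ).prodCongr
      ((ContinuousLinearEquiv.refl ℝ (EuclideanSpace ℝ (Fin (k - 1)))).prodCongr Ry) with hR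
  have hRap : ∀ z : Model n k, R z = (z.1, z.2.1, Ry z.2.2) := fun z => rfl
  set r : (EuclideanSpace ℝ (Fin n)) ≃L[ℝ] EuclideanSpace ℝ (Fin n) := S.L₃.trans (R.trans S.L₃.symm)
    with hr
  have hrap : ∀ v, r v = S.L₃.symm (R (S.L₃ v)) := fun v => rfl
  have hL₃r : ∀ v, S.L₃ (r v) = R (S.L₃ v) := fun v => by rw [hrap, ContinuousLinearEquiv.apply_symm_apply]
  refine ⟨r, ?_, fun v => ?_, fun v hv => ?_⟩
  · -- determinant
    have hdetR : LinearMap.det (R.toLinearEquiv : Model n k →ₗ[ℝ] Model n k) = -1 := by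
      have hReq : (R.toLinearEquiv : Model n k →ₗ[ℝ] Model n k) =
          LinearMap.prodMap LinearMap.id (LinearMap.prodMap LinearMap.id
            ((coordReflection j0).toLinearEquiv : (EuclideanSpace ℝ (Fin (n - k))) →ₗ[ℝ]
              EuclideanSpace ℝ (Fin (n - k)))) := by
        apply LinearMap.ext
        intro z
        rfl
      rw [hReq, LinearMap.det_prodMap, LinearMap.det_prodMap, LinearMap.det_id, LinearMap.det_id,
        det_coordReflection]
      norm_num
    have hconj : (r.toLinearEquiv : (EuclideanSpace ℝ (Fin n)) →ₗ[ℝ] EuclideanSpace ℝ (Fin n)) =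
        ((S.L₃.symm.toLinearEquiv : Model n k ≃ₗ[ℝ] EuclideanSpace ℝ (Fin n)) : Model n k →ₗ[ℝ] _) ∘ₗ
          (R.toLinearEquiv : Model n k →ₗ[ℝ] Model n k) ∘ₗ
          ((S.L₃.symm.toLinearEquiv : Model n k ≃ₗ[ℝ] EuclideanSpace ℝ (Fin n)).symm :
            EuclideanSpace ℝ (Fin n) →ₗ[ℝ] Model n k) := by
      apply LinearMap.ext
      intro v
      rfl
    rw [hconj, LinearMap.det_conj, hdetR]
    norm_num
  · -- preserves the flat
    rw [S.mem_Flat_iff, S.mem_Flat_iff, hL₃r, hRap]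
    simp only
    rw [show Ry (S.L₃ v).2.2 = 0 ↔ (S.L₃ v).2.2 = 0 from Ry.map_eq_zero_iff]
  · -- fixes the flat pointwise
    rw [S.mem_Flat_iff] at hv
    rw [hrap, hRap]
    have : ((S.L₃ v).1, (S.L₃ v).2.1, Ry (S.L₃ v).2.2) = S.L₃ v := by
      rw [hv.2, map_zero]
      ext <;> simp [hv.2]
    rw [this, ContinuousLinearEquiv.symm_apply_apply]

end SlideSetting

end Docking

section DockingHeavy

variable {n : ℕ} {M N : Type u} [TopologicalSpace M] [T2Space M] [SecondCountableTopology M]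
  [ChartedSpace (EuclideanSpace ℝ (Fin n)) M] [IsManifold (𝓡 n) ∞ M] [CompactSpace M]
  [TopologicalSpace N] [T2Space N] [SecondCountableTopology N]
  [ChartedSpace (EuclideanSpace ℝ (Fin n)) N] [IsManifold (𝓡 n) ∞ N] [CompactSpace N]

namespace SlideSetting

variable {c : Cobordism n M N} {g : c.W → ℝ}
  {ξ : Cₛ^∞⟮𝓡∂ (n + 1); EuclideanSpace ℝ (Fin (n + 1)), (TangentSpace (𝓡∂ (n + 1)) : c.W → Type)⟯}
  {t₀ t₁ b : ℝ} {k a : ℕ} {σ : Fin a → c.W} {i j : Fin a}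
  (S : SlideSetting c g ξ t₀ t₁ b k σ i j)

/-- **The docking** (Milnor 1965, Lemma 7.7, property 2.) for `S_L`, realised by an isotopy of
the level): for each isometry `ρ` of the sheet directions there are a diffeomorphism `f` of `V`,
compactly diffeotopic to the identity inside `W = V ∖ ⋃ S_R(σ l)` (so that every stage of a
diffeotopy from the identity to `f` is the identity near all right-hand spheres), and a linear
automorphism `τ` of `ℝⁿ` which preserves the flat and fixes it pointwise, such that
`f (discA ρ (τ v)) = discB v` for all `‖v‖ ≤ 1` (so `f (discA ρ v) = discB v` on the flat): the unoriented
disc theorem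
(`exists_isCompactlyDiffeotopicToIdIn_apply_disc_eq_or_reflect`) for the discs `discA ρ` and
`discB` in the preconnected open `W` (`SlideSetting.isPreconnected_W`, `range_discA_subset_W`,
`range_discB_subset_W`), the reflection being `SlideSetting.exists_reflection_flat`.  Consequently
**`f(S_L) ∩ discB(B̄(0, 1)) = discB(B̄(0, 1) ∩ Flat)`**: inside the control ball the moved left
sphere is exactly the flat sheet `{s = 1, y = 0}` of the model about `S_R(σ j)`.
[cite: MilnorHCobordism1965, Lemma 7.7 and proof of Thm. 7.6 (PDF pp. 50–52); HirschDT1976, Ch. 8 §3, Thm. 3.1] -/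
theorem exists_docking (ρ : (EuclideanSpace ℝ (Fin (k - 1))) ≃ₗᵢ[ℝ] EuclideanSpace ℝ (Fin (k - 1))) :
    ∃ f : S.V ≃ₘ⟮𝓡 n, 𝓡 n⟯ S.V, Diffeomorph.IsCompactlyDiffeotopicToIdIn S.W f ∧
      ∃ τ : (EuclideanSpace ℝ (Fin n)) ≃L[ℝ] EuclideanSpace ℝ (Fin n),
        (∀ v, τ v ∈ S.Flat ↔ v ∈ S.Flat) ∧ (∀ v ∈ S.Flat, τ v = v) ∧
        (∀ v : EuclideanSpace ℝ (Fin n), ‖v‖ ≤ 1 → f (S.discA ρ (τ v)) = S.discB v) ∧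
        (∀ v ∈ S.Flat, ‖v‖ ≤ 1 → f (S.discA ρ v) = S.discB v) ∧
        f '' S.leftSphere ∩ S.discB '' closedBall 0 1 = S.discB '' (closedBall 0 1 ∩ (S.Flat : Set _)) := by
  obtain ⟨r, hr, hrFlat, hrfix⟩ := S.exists_reflection_flat
  obtain ⟨f, hfW, hf⟩ := exists_isCompactlyDiffeotopicToIdIn_apply_disc_eq_or_reflect
    (S.isSmoothEmbedding_discA ρ) S.isSmoothEmbedding_discB r hr S.isOpen_W S.isPreconnected_W
    (S.range_discA_subset_W ρ) S.range_discB_subset_W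
  -- the automorphism `τ`
  obtain ⟨τ, hτFlat, hτfix, hτ⟩ : ∃ τ : (EuclideanSpace ℝ (Fin n)) ≃L[ℝ] EuclideanSpace ℝ (Fin n),
      (∀ v, τ v ∈ S.Flat ↔ v ∈ S.Flat) ∧ (∀ v ∈ S.Flat, τ v = v) ∧
      ∀ v : EuclideanSpace ℝ (Fin n), ‖v‖ ≤ 1 → f (S.discA ρ (τ v)) = S.discB v := by
    rcases hf with h | h
    · exact ⟨ContinuousLinearEquiv.refl ℝ _, fun v => Iff.rfl, fun v _ => rfl, h⟩
    · exact ⟨r, hrFlat, hrfix, h⟩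
  refine ⟨f, hfW, τ, hτFlat, hτfix, hτ, fun v hvF hv => ?_, ?_⟩
  · have h := hτ v hv
    rwa [hτfix v hvF] at h
  ext y
  constructor
  · rintro ⟨⟨q, hq, rfl⟩, ⟨v, hv, hqv⟩⟩
    rw [mem_closedBall, dist_zero_right] at hv
    have hfq : f q = f (S.discA ρ (τ v)) := by rw [hτ v hv, hqv]
    have hq' : q = S.discA ρ (τ v) := f.injective hfq
    rw [hq', S.discA_mem_leftSphere_iff, hτFlat] at hq
    exact ⟨v, ⟨by rw [mem_closedBall, dist_zero_right]; exact hv, hq⟩, hqv⟩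
  · rintro ⟨v, ⟨hv, hvF⟩, rfl⟩
    rw [mem_closedBall, dist_zero_right] at hv
    refine ⟨⟨S.discA ρ (τ v), ?_, hτ v hv⟩, ⟨v, by rw [mem_closedBall, dist_zero_right]; exact hv, rfl⟩⟩
    rw [S.discA_mem_leftSphere_iff, hτFlat]
    exact hvF

end SlideSetting

end DockingHeavy

end Literature.Topology.FourManifolds

end
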